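import Mathlib
import Summits.Ventures.PercRepro2.Defs
import Summits.Ventures.PercRepro2.Graph
import Summits.Ventures.PercRepro2.OneColourSwitch
import Summits.Ventures.PercRepro2.RegionHubSign
import Summits.Ventures.PercRepro2.SideSwitch
import Summits.Ventures.PercRepro2.SideSwitchFibre
import Summits.Ventures.PercRepro2.SideSwitchClosed
import Summits.Ventures.PercRepro2.SideSwitchComps
import Summits.Ventures.PercRepro2.TermSwitchDefs
import Summits.Ventures.PercRepro2.TermSwitchFibre

/-!
# The fibration of the `DZeroH` colourings over the representatives by component assignments
(blind cell PercRepro2, p3 g21, 2026-08-27; `proofs/P3-CPNC.md` §18b (ii)–(iii))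

For a terminal set `H`: the `W`-side of a `sepH ∧ DZeroH` colouring is a union of components of
the sided set (`compIn_subset_BsideH`, `unionT_filter_BsideH`), a component assignment
`assignC T ρ = ρ ⊕ touches (⋃ T)` of a representative `ρ` is a `sepH ∧ DZeroH` colouring with
`W`-side `⋃ T` (`sepH_assignC`, `DZeroH_assignC`, `BsideH_assignC`), and `(ρ, T) ↦ assignC T ρ` is
a bijection `RepH × 2^{compsH ρ} → {sepH ∧ DZeroH}` (`sum_dzeroH_eq_sum_repH_comps`).
`SideSwitchCompsFibre` / `M9DZeroPart` with `H` in place of `{r, s}`.  Own work; std axioms.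
-/

namespace Summit.Ventures.PercRepro2

namespace TermSwitch

open Finset Classical RegionHub OneColourSwitch SideSwitch

variable {V : Type*} {E : Type*}

section Count

variable [Fintype V] [DecidableEq V]

variable {ends : E → Sym2 V}

omit [DecidableEq V] in
/-- Under `DZeroH`, the component of a `W`-side vertex lies on the `W`-side. -/
lemma compIn_subset_BsideH {H : Set V} {ω : Config E} (hD : DZeroH ends H ω) {x : V}
    (hx : x ∈ BsideH ends H ω) :
    compIn ends (↑(A0H ends H ω) : Set V) x ⊆ BsideH ends H ω := by
  intro y hy
  rw [mem_compIn] at hy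
  let Z : Set V := {z | z ∈ A0H ends H ω → z ∈ BsideH ends H ω}
  have hcl : ∀ a ∈ Z, ∀ b, (openGraph ends (chi ends (↑(A0H ends H ω) : Set V))).Adj a b →
      b ∈ Z := by
    intro a ha b hab hbA
    obtain ⟨_, e, he, hends⟩ := openGraph_adj.1 hab
    obtain ⟨u, hu, v, hv, huv⟩ := chi_eq_true_iff.1 he
    have haA : a ∈ A0H ends H ω := by
      rw [hends, Sym2.eq_iff] at huv
      rcases huv with ⟨h1, _⟩ | ⟨h1, _⟩
      · rw [h1]; exact Finset.mem_coe.1 hu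
      · rw [h1]; exact Finset.mem_coe.1 hv
    obtain ⟨haM, haH⟩ := mem_BsideH.1 (ha haA)
    obtain ⟨hbU, hbH⟩ := mem_A0H.1 hbA
    refine mem_BsideH.2 ⟨?_, hbH⟩
    by_contra hbM
    -- `b ∈ K_H ∖ M_H` adjacent to `a ∈ M_H`: the edge is open, so `a ∈ K_H`, against `DZeroH`
    have he1 : ω e = true := open_of_mem_MH_of_not_mem haM hbM hends
    have hbK : b ∈ KH ends H ω := by
      rcases hbU with hbK | hbM'
      · exact hbK
      · exact (hbM hbM').elim
    have haK : a ∈ KH ends H ω := mem_KH_of_open hbK he1 (by rw [hends, Sym2.eq_swap])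
    exact hD a haH haK haM
  have hxZ : x ∈ Z := fun _ => hx
  have hyZ : y ∈ Z := mem_of_conn_of_closed hcl hxZ hy
  exact hyZ (Finset.mem_coe.1 (mem_of_mem_compIn
    (Finset.mem_coe.2 (BsideH_subset_A0H H ω hx)) (mem_compIn.2 hy)))

omit [DecidableEq V] in
/-- Under `DZeroH`, the `W`-side is closed inside the sided set. -/
lemma closedIn_BsideH {H : Set V} {ω : Config E} (hD : DZeroH ends H ω) :
    ClosedIn ends (sidedH ends H ω) (↑(BsideH ends H ω) : Set V) := by
  intro e a b hends ha hb
  rw [sidedH_eq_coe_A0H] at hb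
  have haA : a ∈ A0H ends H ω := BsideH_subset_A0H H ω (Finset.mem_coe.1 ha)
  have he : chi ends (↑(A0H ends H ω) : Set V) e = true :=
    chi_eq_true_iff.2 ⟨a, Finset.mem_coe.2 haA, b, hb, hends⟩
  exact Finset.mem_coe.2 (compIn_subset_BsideH hD (Finset.mem_coe.1 ha)
    (mem_compIn.2 (conn_of_openAdj ⟨e, he, hends⟩)))

/-- Under `DZeroH`, the `W`-side is the union of the components it contains. -/
lemma unionT_filter_BsideH {H : Set V} {ω : Config E} (hD : DZeroH ends H ω) :
    unionT ((compsH ends H ω).filter (fun C => C ⊆ BsideH ends H ω)) = BsideH ends H ω := by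
  ext x
  rw [mem_unionT]
  constructor
  · rintro ⟨C, hC, hxC⟩
    exact (Finset.mem_filter.1 hC).2 hxC
  · intro hx
    exact ⟨compIn ends (↑(A0H ends H ω) : Set V) x, Finset.mem_filter.2
      ⟨Finset.mem_image.2 ⟨x, BsideH_subset_A0H H ω hx, rfl⟩, compIn_subset_BsideH hD hx⟩,
      mem_compIn_self _ _⟩

/-! ## Side assignments by components -/

/-- The switch data of a union of components. -/
lemma switch_data_unionT_H {H : Set V} {ρ : Config E} {T : Finset (Finset V)}
    (hT : T ⊆ compsH ends H ρ) :
    (↑(unionT T) : Set V) ⊆ KH ends H ρ ∪ MH ends H ρ ∧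
      (∀ x ∈ (↑(unionT T) : Set V), x ∉ H) ∧
      ClosedIn ends (sidedH ends H ρ) (↑(unionT T) : Set V) := by
  obtain ⟨h1, h2⟩ := subset_UH_of_subset_A0H (unionT_subset_A0H hT)
  exact ⟨h1, h2, closedIn_unionT_H hT⟩

/-- A component assignment of a `sepH`-colouring is a `sepH`-colouring. -/
lemma sepH_assignC {p q : V} {H : Set V} {ρ : Config E} (h : sepH ends p q H ρ)
    {T : Finset (Finset V)} (hT : T ⊆ compsH ends H ρ) :
    sepH ends p q H (assignC ends T ρ) := by
  obtain ⟨h1, h2, h3⟩ := switch_data_unionT_H hT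
  exact sepH_flipTouch_of_closed h h1 h2 h3

/-- `A0H` is preserved by a component assignment. -/
lemma A0H_assignC {H : Set V} {ρ : Config E} {T : Finset (Finset V)}
    (hT : T ⊆ compsH ends H ρ) : A0H ends H (assignC ends T ρ) = A0H ends H ρ := by
  obtain ⟨_, h2, h3⟩ := switch_data_unionT_H hT
  ext x
  simp only [mem_A0H, assignC, assign]
  rw [UH_flipTouch_of_closed h2 h3]

/-- The components are preserved by a component assignment. -/
lemma compsH_assignC {H : Set V} {ρ : Config E} {T : Finset (Finset V)}
    (hT : T ⊆ compsH ends H ρ) : compsH ends H (assignC ends T ρ) = compsH ends H ρ := by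
  simp only [compsH, A0H_assignC hT]

variable [Fintype E] [DecidableEq E]

/-- The `W`-side of a component assignment of a representative is the assigned union. -/
lemma BsideH_assignC {p q : V} {H : Set V} {ρ : Config E} (hρ : ρ ∈ RepH ends p q H)
    {T : Finset (Finset V)} (hT : T ⊆ compsH ends H ρ) :
    BsideH ends H (assignC ends T ρ) = unionT T := by
  obtain ⟨_, hM⟩ := mem_RepH.1 hρ
  obtain ⟨_, h2, h3⟩ := switch_data_unionT_H hT
  have hTA := unionT_subset_A0H hT
  ext x
  simp only [mem_BsideH, assignC, assign]
  rw [MH_flipTouch_of_closed h2 h3]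
  constructor
  · rintro ⟨(⟨hxM, _⟩ | ⟨hxT, _⟩), hxH⟩
    · exact (hxH (hM x hxM)).elim
    · exact hxT
  · intro hxT
    exact ⟨Or.inr ⟨hxT, A0H_subset_KH_of_mem_RepH hρ (hTA hxT)⟩, h2 x hxT⟩

/-- `nuH` of a component assignment of a representative is the representative. -/
lemma nuH_assignC {p q : V} {H : Set V} {ρ : Config E} (hρ : ρ ∈ RepH ends p q H)
    {T : Finset (Finset V)} (hT : T ⊆ compsH ends H ρ) :
    nuH ends H (assignC ends T ρ) = ρ := by
  rw [nuH, BsideH_assignC hρ hT, assignC, assign, flipTouch_flipTouch]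

omit [DecidableEq V] in
/-- `nuH` of a `sepH ∧ DZeroH` colouring is a representative. -/
lemma nuH_mem_RepH_of_DZeroH {p q : V} {H : Set V} {ω : Config E} (h : sepH ends p q H ω)
    (hD : DZeroH ends H ω) : nuH ends H ω ∈ RepH ends p q H := by
  obtain ⟨hC, hCH⟩ := subset_UH_of_subset_A0H (BsideH_subset_A0H (ends := ends) H ω)
  have hcl := closedIn_BsideH hD
  rw [mem_RepH, nuH]
  refine ⟨sepH_flipTouch_of_closed h hC hCH hcl, ?_⟩
  intro x hx
  rw [MH_flipTouch_of_closed hCH hcl] at hx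
  rcases hx with ⟨hxM, hxB⟩ | ⟨hxB, hxK⟩
  · by_contra hx'
    exact hxB (mem_BsideH.2 ⟨hxM, hx'⟩)
  · obtain ⟨hxM, hxH⟩ := mem_BsideH.1 hxB
    exact (hD x hxH hxK hxM).elim

/-- A component assignment of a representative has no doubly reached vertex outside `H`. -/
lemma DZeroH_assignC {p q : V} {H : Set V} {ρ : Config E} (hρ : ρ ∈ RepH ends p q H)
    {T : Finset (Finset V)} (hT : T ⊆ compsH ends H ρ) : DZeroH ends H (assignC ends T ρ) := by
  obtain ⟨_, hM⟩ := mem_RepH.1 hρ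
  obtain ⟨_, h2, h3⟩ := switch_data_unionT_H hT
  intro x hxH hK hMx
  simp only [assignC, assign] at hK hMx
  rw [KH_flipTouch_of_closed h2 h3] at hK
  rw [MH_flipTouch_of_closed h2 h3] at hMx
  rcases hK with ⟨_, hxT⟩ | ⟨_, hxM⟩
  · rcases hMx with ⟨hxM, _⟩ | ⟨hxT', _⟩
    · exact hxH (hM x hxM)
    · exact hxT hxT'
  · exact hxH (hM x hxM)

/-- The `sepH ∧ DZeroH` colourings. -/
noncomputable def DZeroSetH (ends : E → Sym2 V) (p q : V) (H : Set V) : Finset (Config E) :=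
  (SepSetH ends p q H).filter (fun ω => DZeroH ends H ω)

omit [Fintype V] [DecidableEq V] in
/-- Membership in the `sepH ∧ DZeroH` colourings. -/
lemma mem_DZeroSetH {p q : V} {H : Set V} {ω : Config E} :
    ω ∈ DZeroSetH ends p q H ↔ sepH ends p q H ω ∧ DZeroH ends H ω := by
  simp [DZeroSetH, SepSetH]

omit [Fintype E] [DecidableEq E] in
/-- The components of a `DZeroH` colouring are those of its normalisation. -/
lemma compsH_nuH {H : Set V} {ω : Config E} (hD : DZeroH ends H ω) :
    compsH ends H (nuH ends H ω) = compsH ends H ω := by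
  have hB := closedIn_BsideH hD
  obtain ⟨_, hCH⟩ := subset_UH_of_subset_A0H (BsideH_subset_A0H (ends := ends) H ω)
  simp only [compsH, nuH]
  have hA : A0H ends H (flipTouch ends (↑(BsideH ends H ω) : Set V) ω) = A0H ends H ω := by
    ext x
    simp only [mem_A0H]
    rw [UH_flipTouch_of_closed hCH hB]
  rw [hA]

/-- **The `sepH ∧ DZeroH` colourings of ANY graph are fibred over the representatives by the
component assignments.** -/
theorem sum_dzeroH_eq_sum_repH_comps {p q : V} {H : Set V} (f : Config E → ℤ) :
    ∑ ω ∈ DZeroSetH ends p q H, f ω =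
      ∑ ρ ∈ RepH ends p q H, ∑ T ∈ (compsH ends H ρ).powerset, f (assignC ends T ρ) := by
  have hmaps : ∀ ω ∈ DZeroSetH ends p q H, nuH ends H ω ∈ RepH ends p q H := fun ω hω =>
    nuH_mem_RepH_of_DZeroH (mem_DZeroSetH.1 hω).1 (mem_DZeroSetH.1 hω).2
  rw [← Finset.sum_fiberwise_of_maps_to hmaps]
  refine Finset.sum_congr rfl (fun ρ hρ => ?_)
  refine Finset.sum_nbij' (fun ω => (compsH ends H ρ).filter (fun C => C ⊆ BsideH ends H ω))
    (fun T => assignC ends T ρ) ?_ ?_ ?_ ?_ ?_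
  · intro ω _
    exact Finset.mem_powerset.2 (Finset.filter_subset _ _)
  · intro T hT
    rw [Finset.mem_powerset] at hT
    rw [Finset.mem_filter, mem_DZeroSetH]
    exact ⟨⟨sepH_assignC (mem_RepH.1 hρ).1 hT, DZeroH_assignC hρ hT⟩, nuH_assignC hρ hT⟩
  · intro ω hω
    rw [Finset.mem_filter] at hω
    obtain ⟨hωS, hων⟩ := hω
    obtain ⟨_, hDω⟩ := mem_DZeroSetH.1 hωS
    have hcomps : compsH ends H ρ = compsH ends H ω := by
      rw [← hων]; exact compsH_nuH hDω
    rw [hcomps, assignC, unionT_filter_BsideH hDω, ← hων, nuH, assign, flipTouch_flipTouch]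
  · intro T hT
    rw [Finset.mem_powerset] at hT
    rw [BsideH_assignC hρ hT, filter_subset_unionT_H hT]
  · intro ω hω
    rw [Finset.mem_filter] at hω
    obtain ⟨hωS, hων⟩ := hω
    obtain ⟨_, hDω⟩ := mem_DZeroSetH.1 hωS
    have hcomps : compsH ends H ρ = compsH ends H ω := by
      rw [← hων]; exact compsH_nuH hDω
    rw [hcomps, assignC, unionT_filter_BsideH hDω, ← hων, nuH, assign, flipTouch_flipTouch]

end Count

end TermSwitch

end Summit.Ventures.PercRepro2
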